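import Summits.HubbardSuperconductivity.HubbardSuperconductivity.Theorems.AnisotropyChordTransferFibre3TwoHoleBSPointSkeleton
import Summits.HubbardSuperconductivity.HubbardSuperconductivity.Theorems.AnisotropyChordTransferFibre3TwoHoleBSMargin

/-!
# Route `AnisotropyChord` / H0 rotor rung: the REDUCED two-hole map at infinite capacity — Perron null vector and lifted margin on `Fin 2 ⊕ Fin n`

Twenty-fifth file of the `TwoHoleBS` (PROP BS) chain; third stone of the reduced-slot treatment of the overlapping-cross near classes
(memo HOLE2NEAR-LEAN-g3 §5(a)).  Generalisation of `…TwoHoleBSNearInf` (capacity decomposition), `…TwoHoleBSPerron` (null vector)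
and `…TwoHoleBSMargin` (2×2 lift) from the ten slots to a point family `Fin 2 ⊕ Fin n` with boundary weights `N`:
* `smInvKinf` (`E∞ = −A⁻¹ + x xᵀ/s`), `redPinf` (`P∞ = [E∞]_live − ½·diag N`), `smInvK_eq_inf`, ★ `redP_quad_eq_inf`
  (`wᵀP_D(Λ)w = wᵀP∞w + (x_live·w)²/(s(Λs−1))`);
* ★ PERRON from a test vector: if `A·v = 1_ζ` with `v = (α on the centres, ½N on the live points)` and `Σv = 0`, then
  `sum_xvecK_centre` (`Σ_ζ x = 0`), `xvecK_live_sum` (`x_live·1 = s`), ★★ `redPinf_mulVec_one` (`P∞·1 = 0`);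
* ★★ `lift_marginK` (exact-null-vector 2×2 compression on `Fin n`), ★★ `redP_quad_ge_liftMarginK`
  (`P_D(Λ) ⪰ liftMargin-type bound ρs²g/(n(g + ρ‖x_live‖²))` for `Λs > 1`, given the gap `g` of `P∞` on zero-sum vectors).
The identity `A∞·v = 1_ζ` for the three classes (`α = −3/2` for `(1,0)`, `−2` for `(1,1),(2,0)`) is harmonicity bookkeeping on the
ℤ² table, and the gap/CND/enclosures are kernel certificates as for the disjoint classes — left to the successor.
Prover seat `hubbard-h0-rotor-p2` g3; helper for stmt-HubbardSuperconductivity-19089 (`--supports`, helper class).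
WHAT THIS IS NOT: nothing here proves superconductivity in the Hubbard model; the rotor TARGET as originally worded stays
FALSE (g15 verdict).  Interface only.  Mathlib + tree imports only; no sorry, no axioms.
-/

set_option linter.dupNamespace false
set_option autoImplicit false

noncomputable section

open scoped BigOperators
open Complex Finset

namespace Summit.HubbardSuperconductivity.HubbardSuperconductivity.Theorems.AnisotropyChord.Transfer.Fibre3

namespace TwoHoleBS

variable {n : ℕ}

/-! ## The capacity decomposition on the family -/

/-- `E∞ = −A⁻¹ + x xᵀ/s`. [folklore] -/
def smInvKinf (A : Matrix (Fin 2 ⊕ Fin n) (Fin 2 ⊕ Fin n) ℝ) : Matrix (Fin 2 ⊕ Fin n) (Fin 2 ⊕ Fin n) ℝ :=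
  -A⁻¹ + (1 / svecK A) • Matrix.vecMulVec (xvecK A) (xvecK A)

/-- `P∞ = [E∞]_live − ½·diag N`. [folklore] -/
def redPinf (A : Matrix (Fin 2 ⊕ Fin n) (Fin 2 ⊕ Fin n) ℝ) (N : Fin n → ℝ) : Matrix (Fin n) (Fin n) ℝ :=
  Matrix.of fun i j => smInvKinf A (Sum.inr i) (Sum.inr j) - (if i = j then N i / 2 else 0)

/-- `E(Λ)_{pq} = E∞_{pq} + x_p x_q/(s(Λs − 1))`. [folklore] -/
theorem smInvK_eq_inf (A : Matrix (Fin 2 ⊕ Fin n) (Fin 2 ⊕ Fin n) ℝ) (Λ : ℝ) (hs : svecK A ≠ 0)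
    (hΛ : Λ * svecK A - 1 ≠ 0) (p q : Fin 2 ⊕ Fin n) :
    smInvK A Λ p q = smInvKinf A p q + xvecK A p * xvecK A q / (svecK A * (Λ * svecK A - 1)) := by
  simp only [smInvK, smInvKinf, Matrix.add_apply, Matrix.smul_apply, Matrix.vecMulVec_apply, smul_eq_mul, Matrix.neg_apply]
  field_simp
  ring

/-- ★ `wᵀP_D(Λ)w = wᵀP∞w + (x_live·w)²/(s(Λs − 1))`. [folklore] -/
theorem redP_quad_eq_inf (A : Matrix (Fin 2 ⊕ Fin n) (Fin 2 ⊕ Fin n) ℝ) (Λ : ℝ) (N : Fin n → ℝ) (hs : svecK A ≠ 0)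
    (hΛ : Λ * svecK A - 1 ≠ 0) (w : Fin n → ℝ) :
    dotProduct w ((redP A Λ N).mulVec w)
      = dotProduct w ((redPinf A N).mulVec w)
        + (∑ i, xvecK A (Sum.inr i) * w i) ^ 2 / (svecK A * (Λ * svecK A - 1)) := by
  set D := svecK A * (Λ * svecK A - 1) with hD
  set S := ∑ i, xvecK A (Sum.inr i) * w i with hS
  have hrow : ∀ i, (redP A Λ N).mulVec w i = (redPinf A N).mulVec w i + xvecK A (Sum.inr i) * S / D := by
    intro i
    rw [mulVec_apply_sum, mulVec_apply_sum]
    have e : ∀ j, redP A Λ N i j * w j = redPinf A N i j * w j + xvecK A (Sum.inr i) * (xvecK A (Sum.inr j) * w j) / D := by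
      intro j
      simp only [redP, redPinf, Matrix.of_apply]
      rw [smInvK_eq_inf A Λ hs hΛ, hD]
      ring
    simp only [e, Finset.sum_add_distrib]
    congr 1
    rw [hS, Finset.mul_sum, Finset.sum_div]
  unfold dotProduct
  simp only [hrow, mul_add, Finset.sum_add_distrib]
  congr 1
  rw [hS, sq, Finset.sum_mul, Finset.sum_div]
  refine Finset.sum_congr rfl fun i _ => ?_
  ring

/-! ## The Perron null vector from a test vector -/

section Perron

variable (A : Matrix (Fin 2 ⊕ Fin n) (Fin 2 ⊕ Fin n) ℝ) (N : Fin n → ℝ) (α : ℝ)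

/-- the test vector `v = (α, α | ½N)`. [folklore] -/
def testV (N : Fin n → ℝ) (α : ℝ) : Fin 2 ⊕ Fin n → ℝ := Sum.elim (fun _ => α) (fun j => N j / 2)

/-- the indicator of the two centres. [folklore] -/
def oneZ : Fin 2 ⊕ Fin n → ℝ := Sum.elim (fun _ => 1) (fun _ => 0)

/-- the inverse of a symmetric matrix is symmetric. [folklore] -/
theorem inv_isSymmK (hsymm : A.IsSymm) : (A⁻¹).IsSymm := by
  unfold Matrix.IsSymm at *
  rw [Matrix.transpose_nonsing_inv, hsymm]

/-- `A⁻¹1_ζ = v`. [folklore] -/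
theorem inv_mulVec_oneZ (hA : IsUnit A.det) (hv : A.mulVec (testV N α) = oneZ) :
    A⁻¹.mulVec (oneZ : Fin 2 ⊕ Fin n → ℝ) = testV N α := by
  rw [← hv, Matrix.mulVec_mulVec, Matrix.nonsing_inv_mul _ hA, Matrix.one_mulVec]

/-- ★ the harmonic-measure vector has zero centre sum: `x_{ζ₁} + x_{ζ₂} = Σ v = 0`. [folklore] -/
theorem sum_xvecK_centre (hsymm : A.IsSymm) (hA : IsUnit A.det) (hv : A.mulVec (testV N α) = oneZ)
    (hsum : ∑ k, testV N α k = 0) : xvecK A (Sum.inl 0) + xvecK A (Sum.inl 1) = 0 := by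
  have h1 : xvecK A (Sum.inl 0) + xvecK A (Sum.inl 1) = dotProduct oneZ (xvecK A) := by
    simp only [dotProduct, Fintype.sum_sum_type, oneZ, Sum.elim_inl, Sum.elim_inr, Fin.sum_univ_two, one_mul, zero_mul,
      Finset.sum_const_zero, add_zero]
  rw [h1, xvecK, Matrix.dotProduct_mulVec, ← Matrix.mulVec_transpose, (inv_isSymmK A hsymm).eq,
    inv_mulVec_oneZ A N α hA hv]
  simp only [dotProduct, mul_one]
  exact hsum

/-- ★ `x_live·1 = s`. [folklore] -/
theorem xvecK_live_sum (hsymm : A.IsSymm) (hA : IsUnit A.det) (hv : A.mulVec (testV N α) = oneZ)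
    (hsum : ∑ k, testV N α k = 0) : ∑ j : Fin n, xvecK A (Sum.inr j) = svecK A := by
  have h := sum_xvecK_centre A N α hsymm hA hv hsum
  unfold svecK
  rw [Fintype.sum_sum_type, Fin.sum_univ_two]
  linarith

/-- `E∞·1 = 0`. [folklore] -/
theorem smInvKinf_row_sum (hs : svecK A ≠ 0) (p : Fin 2 ⊕ Fin n) : ∑ q, smInvKinf A p q = 0 := by
  simp only [smInvKinf, Matrix.add_apply, Matrix.neg_apply, Matrix.smul_apply, Matrix.vecMulVec_apply, smul_eq_mul,
    Finset.sum_add_distrib, Finset.sum_neg_distrib, ← Finset.mul_sum]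
  have hx : ∑ q, (A⁻¹) p q = xvecK A p := by simp [xvecK, Matrix.mulVec, dotProduct]
  rw [hx]
  have e : 1 / svecK A * (xvecK A p * ∑ k, xvecK A k) = xvecK A p := by
    unfold svecK at hs ⊢
    field_simp
  rw [e]
  ring

/-- ★★ **PERRON IDENTITY on the family:** `P∞·1 = 0`. [folklore] -/
theorem redPinf_mulVec_one (hsymm : A.IsSymm) (hA : IsUnit A.det) (hs : svecK A ≠ 0)
    (hv : A.mulVec (testV N α) = oneZ) (hsum : ∑ k, testV N α k = 0) :
    (redPinf A N).mulVec (fun _ => (1 : ℝ)) = 0 := by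
  funext i
  rw [mulVec_apply_sum]
  simp only [redPinf, Matrix.of_apply, mul_one, Pi.zero_apply, Finset.sum_sub_distrib, Finset.sum_ite_eq,
    Finset.mem_univ, if_true]
  -- `Σ_j E∞(inr i, inr j) = −Σ_c E∞(inr i, inl c) = (A⁻¹1_ζ)_{inr i} − x_i(Σ_ζ x)/s = N_i/2`
  have hrow := smInvKinf_row_sum A hs (Sum.inr i)
  rw [Fintype.sum_sum_type, Fin.sum_univ_two] at hrow
  have hcen : smInvKinf A (Sum.inr i) (Sum.inl 0) + smInvKinf A (Sum.inr i) (Sum.inl 1) = -(N i / 2) := by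
    have hinv : (A⁻¹) (Sum.inr i) (Sum.inl 0) + (A⁻¹) (Sum.inr i) (Sum.inl 1) = N i / 2 := by
      have h := congrFun (inv_mulVec_oneZ A N α hA hv) (Sum.inr i)
      rw [mulVec_apply_sum] at h
      simp only [Fintype.sum_sum_type, oneZ, Sum.elim_inl, Sum.elim_inr, Fin.sum_univ_two, mul_one, mul_zero,
        Finset.sum_const_zero, add_zero, testV] at h
      exact h
    have hc := sum_xvecK_centre A N α hsymm hA hv hsum
    simp only [smInvKinf, Matrix.add_apply, Matrix.neg_apply, Matrix.smul_apply, Matrix.vecMulVec_apply, smul_eq_mul]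
    have e : -(A⁻¹) (Sum.inr i) (Sum.inl 0) + 1 / svecK A * (xvecK A (Sum.inr i) * xvecK A (Sum.inl 0))
        + (-(A⁻¹) (Sum.inr i) (Sum.inl 1) + 1 / svecK A * (xvecK A (Sum.inr i) * xvecK A (Sum.inl 1)))
        = -((A⁻¹) (Sum.inr i) (Sum.inl 0) + (A⁻¹) (Sum.inr i) (Sum.inl 1))
          + 1 / svecK A * xvecK A (Sum.inr i) * (xvecK A (Sum.inl 0) + xvecK A (Sum.inl 1)) := by ring
    rw [e, hinv, hc]
    ring
  linarith

end Perron

/-! ## The 2×2 lift on `Fin n` -/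

/-- ★★ **LIFT LEMMA on `Fin n`:** `P` symmetric, `P·1 = 0`, `P ≥ g > 0` on zero-sum vectors ⇒
`P + ρ·x xᵀ ⪰ ρX²g/(n(g + ρ‖x‖²))`, `X = Σx`. [folklore] -/
theorem lift_marginK (hn : 0 < n) (P : Matrix (Fin n) (Fin n) ℝ) (hP : P.IsSymm) (h0 : P.mulVec (fun _ => (1 : ℝ)) = 0)
    (g : ℝ) (hg : 0 < g) (hgap : ∀ w : Fin n → ℝ, ∑ i, w i = 0 → g * dotProduct w w ≤ dotProduct w (P.mulVec w))
    (x : Fin n → ℝ) (hx : 0 < dotProduct x x) (ρ : ℝ) (hρ : 0 < ρ) (v : Fin n → ℝ) :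
    ρ * (∑ i, x i) ^ 2 * g / ((n : ℝ) * (g + ρ * dotProduct x x)) * dotProduct v v
      ≤ dotProduct v (P.mulVec v) + ρ * (dotProduct x v) ^ 2 := by
  have hnr : (0 : ℝ) < n := by exact_mod_cast hn
  set S := ∑ i, v i with hS
  set X := ∑ i, x i with hX
  set w : Fin n → ℝ := fun i => v i - S / n with hw
  have hcard : (Finset.univ : Finset (Fin n)).card = n := by simp
  have hsumw : ∑ i, w i = 0 := by
    simp only [hw, Finset.sum_sub_distrib, Finset.sum_const, hcard, nsmul_eq_mul, ← hS]
    field_simp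
    ring
  have hv : v = w + fun _ => S / n := by funext i; simp [hw]
  have hcdot : ∀ u : Fin n → ℝ, dotProduct (fun _ => S / n) u = (S / n) * ∑ i, u i := by
    intro u; simp only [dotProduct, Finset.mul_sum]
  have h1w : dotProduct (fun _ => (1 : ℝ)) (P.mulVec w) = 0 := by
    rw [Matrix.dotProduct_mulVec, ← Matrix.mulVec_transpose, hP.eq, h0, zero_dotProduct]
  have hPv : P.mulVec v = P.mulVec w := by
    rw [hv, Matrix.mulVec_add]
    have : P.mulVec (fun _ => S / n) = (S / n) • P.mulVec (fun _ => (1 : ℝ)) := by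
      rw [← Matrix.mulVec_smul]; congr 1; funext i; simp
    rw [this, h0, smul_zero, add_zero]
  have hquad : dotProduct v (P.mulVec v) = dotProduct w (P.mulVec w) := by
    rw [hPv, hv, add_dotProduct, hcdot]
    have : ∑ i, P.mulVec w i = dotProduct (fun _ => (1 : ℝ)) (P.mulVec w) := by simp only [dotProduct, one_mul]
    rw [this, h1w, mul_zero, add_zero]
  have hnorm : dotProduct v v = dotProduct w w + S ^ 2 / n := by
    rw [hv, add_dotProduct, dotProduct_add, dotProduct_add, hcdot, hcdot, dotProduct_comm w (fun _ => S / n), hcdot, hsumw]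
    simp only [Finset.sum_const, hcard, nsmul_eq_mul]
    field_simp
    ring
  have hxv : dotProduct x v = S * X / n + dotProduct x w := by
    rw [hv, dotProduct_add, dotProduct_comm x (fun _ => S / n), hcdot, ← hX]
    ring
  have hxw : dotProduct x w = ∑ i, (x i - X / n) * w i := by
    simp only [dotProduct, sub_mul, Finset.sum_sub_distrib, ← Finset.mul_sum, hsumw, mul_zero, sub_zero]
  have hcs : (dotProduct x w) ^ 2 ≤ (dotProduct x x - X ^ 2 / n) * dotProduct w w := by
    rw [hxw]
    refine (Finset.sum_mul_sq_le_sq_mul_sq Finset.univ (fun i => x i - X / n) w).trans (le_of_eq ?_)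
    have e : ∑ i, (x i - X / n) ^ 2 = dotProduct x x - X ^ 2 / n := by
      have : ∀ i, (x i - X / n) ^ 2 = x i * x i - (2 * X / n) * x i + X ^ 2 / n ^ 2 := fun i => by ring
      simp only [this, Finset.sum_add_distrib, Finset.sum_sub_distrib, ← Finset.mul_sum, ← hX, Finset.sum_const, hcard,
        nsmul_eq_mul, dotProduct]
      field_simp
      ring
    rw [e]
    simp only [dotProduct, pow_two]
  have hT : 0 ≤ dotProduct w w := Finset.sum_nonneg fun i _ => mul_self_nonneg _
  have key := scalar_margin g ρ (dotProduct x x) X n S (dotProduct w w) (dotProduct x w) (dotProduct w (P.mulVec w))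
    hnr hg hρ hx hT (hgap w hsumw) hcs
  rw [hnorm, hquad, hxv, add_comm (dotProduct w w)]
  exact key

/-- `P∞` is symmetric for symmetric `A`. [folklore] -/
theorem redPinf_isSymm (A : Matrix (Fin 2 ⊕ Fin n) (Fin 2 ⊕ Fin n) ℝ) (hsymm : A.IsSymm) (N : Fin n → ℝ) :
    (redPinf A N).IsSymm := by
  have h := inv_isSymmK A hsymm
  ext i j
  simp only [redPinf, smInvKinf, Matrix.transpose_apply, Matrix.of_apply, Matrix.add_apply, Matrix.neg_apply,
    Matrix.smul_apply, Matrix.vecMulVec_apply, smul_eq_mul]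
  rw [h.apply (Sum.inr j) (Sum.inr i), mul_comm (xvecK A (Sum.inr j))]
  by_cases hij : i = j
  · subst hij; rfl
  · rw [if_neg hij, if_neg (Ne.symm hij)]

/-- ★★ **THE LIFTED MARGIN OF THE REDUCED MAP:** with the Perron test vector, `s > 0`, a gap `g > 0` of `P∞` on zero-sum vectors
and `Λs > 1`: `P_D(Λ) ⪰ m·1`, `m = ρs²g/(n(g + ρ‖x_live‖²))`, `ρ = 1/(s(Λs − 1))`. [folklore] -/
theorem redP_quad_ge_liftMarginK (hn : 0 < n) (A : Matrix (Fin 2 ⊕ Fin n) (Fin 2 ⊕ Fin n) ℝ) (hsymm : A.IsSymm)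
    (hA : IsUnit A.det) (N : Fin n → ℝ) (α : ℝ) (hv : A.mulVec (testV N α) = oneZ) (hsum : ∑ k, testV N α k = 0)
    (hs : 0 < svecK A) (g : ℝ) (hg : 0 < g)
    (hgap : ∀ w : Fin n → ℝ, ∑ i, w i = 0 → g * dotProduct w w ≤ dotProduct w ((redPinf A N).mulVec w))
    (Λ : ℝ) (hΛ : 1 < Λ * svecK A) (v : Fin n → ℝ) :
    (1 / (svecK A * (Λ * svecK A - 1))) * svecK A ^ 2 * g
        / ((n : ℝ) * (g + (1 / (svecK A * (Λ * svecK A - 1))) * ∑ i, xvecK A (Sum.inr i) ^ 2)) * dotProduct v v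
      ≤ dotProduct v ((redP A Λ N).mulVec v) := by
  set s := svecK A with hsdef
  set xB : Fin n → ℝ := fun i => xvecK A (Sum.inr i) with hxB
  have hρ : 0 < 1 / (s * (Λ * s - 1)) := by
    have : 0 < Λ * s - 1 := by linarith
    positivity
  have hX : ∑ i, xB i = s := xvecK_live_sum A N α hsymm hA hv hsum
  have hxx : dotProduct xB xB = ∑ i, xvecK A (Sum.inr i) ^ 2 := by simp only [dotProduct, hxB, pow_two]
  have hxpos : 0 < dotProduct xB xB := by
    have hcs := Finset.sum_mul_sq_le_sq_mul_sq Finset.univ (fun _ : Fin n => (1 : ℝ)) xB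
    simp only [one_mul, one_pow, Finset.sum_const, Finset.card_univ, Fintype.card_fin, nsmul_eq_mul] at hcs
    rw [hX] at hcs
    have : 0 < s ^ 2 := by positivity
    have hnr : (0 : ℝ) < n := by exact_mod_cast hn
    simp only [dotProduct, ← pow_two]
    nlinarith
  have key := lift_marginK hn (redPinf A N) (redPinf_isSymm A hsymm N) (redPinf_mulVec_one A N α hsymm hA hs.ne' hv hsum)
    g hg hgap xB hxpos (1 / (s * (Λ * s - 1))) hρ v
  rw [hX, hxx] at key
  rw [redP_quad_eq_inf A Λ N hs.ne' (by linarith) v]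
  have hdot : (∑ i, xvecK A (Sum.inr i) * v i) = dotProduct xB v := by simp only [dotProduct, hxB]
  rw [hdot, ← hsdef, div_eq_mul_one_div ((dotProduct xB v) ^ 2), mul_comm ((dotProduct xB v) ^ 2)]
  exact key

end TwoHoleBS

end Summit.HubbardSuperconductivity.HubbardSuperconductivity.Theorems.AnisotropyChord.Transfer.Fibre3

end
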